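import Summits.KontsevichZagierPeriods.KontsevichZagierPeriods.Theorems.RealOnePeriodRelations.Negative.Kit

/-!
# `RealOnePeriodRelations` (stmt-KontsevichZagierPeriods-10042) — negative side I: the Green generator is SOUND

Main results (sorry-free, axioms `propext/Classical.choice/Quot.sound`):
* `green_triangle` — for `A, B` continuous on the CLOSED standard triangle and a `C¹` potential `S`
  of `A da + B db` on the OPEN triangle, `∫₀¹A(t,0)dt + ∫₀¹(B−A)(1−t,t)dt − ∫₀¹B(0,t)dt = 0`
  (FTC along the edges of the shrunken triangles `(ε,ε) + (1−3ε)Δ ⊂ Δ°`, then continuity of the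
  parametric edge integrals at `ε = 0`; no semialgebraicity is used);
* `eval_eq_zero_of_mem_greenSet`, `M₁_le_ker_eval` — the conclusion subgroup of the crux lies in
  `ker eval`: the crux is NOT true for a junk reason, `eval c = 0` is necessary for `c ∈ M₁`, and a
  refutation can only be a value-level counterexample (excluded by Huber–Wüstholz Thm 13.3 (2) as
  printed — see the crux work file `Cruxes/RealOnePeriodRelations/Disproof.lean`).
[Kontsevich–Zagier 2001, §1.2; Huber–Wüstholz 2022, Thm 13.3 (2)]
-/

noncomputable section

open scoped BigOperators Topology
open Set MeasureTheory Filter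
open Literature.NumberTheory.Transcendental

namespace Summit.KontsevichZagierPeriods.SymplecticScissors.RealOnePeriodRelationsNegative

/-! ### §2.2 Green on the standard triangle for continuous coefficients

`∮_{∂Δ} (A da + B db) = 0` whenever `A, B` are continuous on the CLOSED triangle and `A da + B db`
has a `C¹` potential `S` on the OPEN triangle: FTC along the edges of the shrunken triangles
`Δ_ε = (ε,ε) + (1−3ε)Δ ⊂ Δ°` gives `0`, and `ε ↦ ∮_{∂Δ_ε}` is continuous at `ε = 0` (parametric
integrals of a continuous integrand). No semialgebraicity is used. -/

/-- The shrinking map `(ε; a, b) ↦ (ε + (1−3ε)a, ε + (1−3ε)b)`. [folklore] -/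
def shrink (ε a b : ℝ) : Fin 2 → ℝ := ![ε + (1 - 3 * ε) * a, ε + (1 - 3 * ε) * b]

/-- First coordinate of `shrink`. [folklore] -/
@[simp] theorem shrink_apply_zero (ε a b : ℝ) : shrink ε a b 0 = ε + (1 - 3 * ε) * a := rfl

/-- Second coordinate of `shrink`. [folklore] -/
@[simp] theorem shrink_apply_one (ε a b : ℝ) : shrink ε a b 1 = ε + (1 - 3 * ε) * b := rfl

/-- At `ε = 0` the shrinking map is the identity. [folklore] -/
theorem shrink_zero (a b : ℝ) : shrink 0 a b = ![a, b] := by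
  ext i
  fin_cases i <;> simp

/-- Shrunken points of `Δ` lie in the open triangle for `0 < ε < 1/3`. [folklore] -/
theorem shrink_mem_open {ε a b : ℝ} (hε : 0 < ε) (hε' : ε < 1 / 3) (ha : 0 ≤ a) (hb : 0 ≤ b)
    (hab : a + b ≤ 1) :
    0 < shrink ε a b 0 ∧ 0 < shrink ε a b 1 ∧ shrink ε a b 0 + shrink ε a b 1 < 1 := by
  simp only [shrink_apply_zero, shrink_apply_one]
  refine ⟨?_, ?_, ?_⟩ <;> nlinarith

/-- Shrunken points of `Δ` lie in `Δ` for `0 ≤ ε ≤ 1/3`. [folklore] -/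
theorem shrink_mem_Δ {ε a b : ℝ} (hε : 0 ≤ ε) (hε' : ε ≤ 1 / 3) (ha : 0 ≤ a) (hb : 0 ≤ b)
    (hab : a + b ≤ 1) : shrink ε a b ∈ Δ := by
  simp only [Δ, mem_setOf_eq, shrink_apply_zero, shrink_apply_one]
  refine ⟨?_, ?_, ?_⟩ <;> nlinarith

/-- Points of the open triangle lie in `Δ`. [folklore] -/
theorem mem_Δ_of_open {p : Fin 2 → ℝ} (h0 : 0 < p 0) (h1 : 0 < p 1) (h2 : p 0 + p 1 < 1) : p ∈ Δ :=
  ⟨h0.le, h1.le, h2.le⟩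

/-- FTC along a `C¹` path inside the open triangle: `∫₀¹ ⟨(A,B)(γ), γ′⟩ = S(γ 1) − S(γ 0)`.
[folklore] -/
theorem ftc_along {A B S : (Fin 2 → ℝ) → ℝ} (hA : ContinuousOn A Δ) (hB : ContinuousOn B Δ)
    (hS : ∀ p : Fin 2 → ℝ, 0 < p 0 → 0 < p 1 → p 0 + p 1 < 1 →
      HasFDerivAt S (A p • ContinuousLinearMap.proj (R := ℝ) (φ := fun _ : Fin 2 => ℝ) 0 +
        B p • ContinuousLinearMap.proj (R := ℝ) (φ := fun _ : Fin 2 => ℝ) 1) p)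
    (γ : ℝ → Fin 2 → ℝ) (v : Fin 2 → ℝ) (hγc : Continuous γ) (hγd : ∀ t, HasDerivAt γ v t)
    (hγo : ∀ t ∈ Icc (0:ℝ) 1, 0 < γ t 0 ∧ 0 < γ t 1 ∧ γ t 0 + γ t 1 < 1) :
    ∫ t in (0:ℝ)..1, (A (γ t) * v 0 + B (γ t) * v 1) = S (γ 1) - S (γ 0) := by
  have hmaps : MapsTo γ (Icc (0:ℝ) 1) Δ := fun t ht =>
    mem_Δ_of_open (hγo t ht).1 (hγo t ht).2.1 (hγo t ht).2.2
  have key := intervalIntegral.integral_eq_sub_of_hasDerivAt (f := S ∘ γ)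
    (f' := fun t => A (γ t) * v 0 + B (γ t) * v 1) (a := (0:ℝ)) (b := 1) ?_ ?_
  · simpa [Function.comp] using key
  · intro t ht
    rw [uIcc_of_le zero_le_one] at ht
    obtain ⟨h0, h1, h2⟩ := hγo t ht
    have h := (hS (γ t) h0 h1 h2).comp_hasDerivAt t (hγd t)
    convert h using 1
    simp [smul_eq_mul]
  · apply ContinuousOn.intervalIntegrable
    rw [uIcc_of_le zero_le_one]
    exact ((hA.comp hγc.continuousOn hmaps).mul continuousOn_const).add
      ((hB.comp hγc.continuousOn hmaps).mul continuousOn_const)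

/-- Derivative of the bottom edge `t ↦ shrink ε t 0`. [folklore] -/
theorem hasDerivAt_edge₁ (ε t : ℝ) :
    HasDerivAt (fun t => shrink ε t 0) ![1 - 3 * ε, 0] t := by
  rw [hasDerivAt_pi]
  intro i
  fin_cases i
  · simp only [shrink_apply_zero, Fin.zero_eta, Matrix.cons_val_zero]
    simpa using ((hasDerivAt_id t).const_mul (1 - 3 * ε)).const_add ε
  · simp only [shrink_apply_one, Fin.mk_one, Matrix.cons_val_one, Matrix.cons_val_fin_one,
      mul_zero, add_zero]
    exact hasDerivAt_const t ε

/-- Derivative of the hypotenuse `t ↦ shrink ε (1 − t) t`. [folklore] -/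
theorem hasDerivAt_edge₂ (ε t : ℝ) :
    HasDerivAt (fun t => shrink ε (1 - t) t) ![-(1 - 3 * ε), 1 - 3 * ε] t := by
  rw [hasDerivAt_pi]
  intro i
  fin_cases i
  · simp only [shrink_apply_zero, Fin.zero_eta, Matrix.cons_val_zero]
    have h := (((hasDerivAt_id t).const_sub 1).const_mul (1 - 3 * ε)).const_add ε
    simpa using h
  · simp only [shrink_apply_one, Fin.mk_one, Matrix.cons_val_one, Matrix.cons_val_fin_one]
    simpa using ((hasDerivAt_id t).const_mul (1 - 3 * ε)).const_add ε

/-- Derivative of the left edge `t ↦ shrink ε 0 t`. [folklore] -/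
theorem hasDerivAt_edge₃ (ε t : ℝ) :
    HasDerivAt (fun t => shrink ε 0 t) ![0, 1 - 3 * ε] t := by
  rw [hasDerivAt_pi]
  intro i
  fin_cases i
  · simp only [shrink_apply_zero, Fin.zero_eta, Matrix.cons_val_zero, mul_zero, add_zero]
    exact hasDerivAt_const t ε
  · simp only [shrink_apply_one, Fin.mk_one, Matrix.cons_val_one, Matrix.cons_val_fin_one]
    simpa using ((hasDerivAt_id t).const_mul (1 - 3 * ε)).const_add ε

/-- Paths `t ↦ shrink ε (f t) (g t)` with continuous `f, g` are continuous. [folklore] -/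
theorem continuous_shrink₁ (ε : ℝ) (f g : ℝ → ℝ) (hf : Continuous f) (hg : Continuous g) :
    Continuous fun t => shrink ε (f t) (g t) := by
  refine continuous_pi fun i => ?_
  fin_cases i
  · simp only [shrink_apply_zero, Fin.zero_eta]
    fun_prop
  · simp only [shrink_apply_one, Fin.mk_one]
    fun_prop

/-- The three edges are continuous in `(ε, t)` jointly (polynomial maps). [folklore] -/
theorem continuous_shrink₂ (f g h : ℝ × ℝ → ℝ) (hf : Continuous f) (hg : Continuous g)
    (hh : Continuous h) : Continuous fun p : ℝ × ℝ => shrink (f p) (g p) (h p) := by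
  refine continuous_pi fun i => ?_
  fin_cases i
  · simp only [shrink_apply_zero, Fin.zero_eta]
    fun_prop
  · simp only [shrink_apply_one, Fin.mk_one]
    fun_prop

/-- The boundary integral over the shrunken triangle `Δ_ε` VANISHES for `0 < ε < 1/3` (FTC along
the three edges, telescoping sum of potential values at the vertices). [folklore] -/
theorem green_shrunken {A B S : (Fin 2 → ℝ) → ℝ} (hA : ContinuousOn A Δ) (hB : ContinuousOn B Δ)
    (hS : ∀ p : Fin 2 → ℝ, 0 < p 0 → 0 < p 1 → p 0 + p 1 < 1 →
      HasFDerivAt S (A p • ContinuousLinearMap.proj (R := ℝ) (φ := fun _ : Fin 2 => ℝ) 0 +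
        B p • ContinuousLinearMap.proj (R := ℝ) (φ := fun _ : Fin 2 => ℝ) 1) p)
    {ε : ℝ} (hε : 0 < ε) (hε' : ε < 1 / 3) :
    (1 - 3 * ε) * ((∫ t in (0:ℝ)..1, A (shrink ε t 0)) +
      (∫ t in (0:ℝ)..1, (B (shrink ε (1 - t) t) - A (shrink ε (1 - t) t))) -
      ∫ t in (0:ℝ)..1, B (shrink ε 0 t)) = 0 := by
  have h₁ := ftc_along hA hB hS (fun t => shrink ε t 0) ![1 - 3 * ε, 0]
    (continuous_shrink₁ ε (fun t => t) (fun _ => 0) continuous_id continuous_const)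
    (hasDerivAt_edge₁ ε) (fun t ht => shrink_mem_open hε hε' ht.1 le_rfl (by linarith [ht.2]))
  have h₂ := ftc_along hA hB hS (fun t => shrink ε (1 - t) t) ![-(1 - 3 * ε), 1 - 3 * ε]
    (continuous_shrink₁ ε (fun t => 1 - t) (fun t => t) (continuous_const.sub continuous_id)
      continuous_id)
    (hasDerivAt_edge₂ ε)
    (fun t ht => shrink_mem_open hε hε' (by linarith [ht.2]) ht.1 (by linarith))
  have h₃ := ftc_along hA hB hS (fun t => shrink ε 0 t) ![0, 1 - 3 * ε]
    (continuous_shrink₁ ε (fun _ => 0) (fun t => t) continuous_const continuous_id)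
    (hasDerivAt_edge₃ ε) (fun t ht => shrink_mem_open hε hε' le_rfl ht.1 (by linarith [ht.2]))
  simp only [Matrix.cons_val_zero, Matrix.cons_val_one, Matrix.cons_val_fin_one, mul_zero,
    add_zero, zero_add, sub_zero, sub_self, mul_neg] at h₁ h₂ h₃
  have e₁ : (1 - 3 * ε) * ∫ t in (0:ℝ)..1, A (shrink ε t 0) =
      S (shrink ε 1 0) - S (shrink ε 0 0) := by
    rw [← h₁, ← intervalIntegral.integral_const_mul]
    congr 1; funext t; ring
  have e₂ : (1 - 3 * ε) * ∫ t in (0:ℝ)..1, (B (shrink ε (1 - t) t) - A (shrink ε (1 - t) t)) =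
      S (shrink ε 0 1) - S (shrink ε 1 0) := by
    rw [← h₂, ← intervalIntegral.integral_const_mul]
    congr 1; funext t; ring
  have e₃ : (1 - 3 * ε) * ∫ t in (0:ℝ)..1, B (shrink ε 0 t) =
      S (shrink ε 0 1) - S (shrink ε 0 0) := by
    rw [← h₃, ← intervalIntegral.integral_const_mul]
    congr 1; funext t; ring
  rw [mul_sub, mul_add, e₁, e₂, e₃]
  ring


/-- Clamp to `[0, 1]`. [folklore] -/
def cl (t : ℝ) : ℝ := max 0 (min 1 t)

/-- Clamp to `[0, 1/4]`. [folklore] -/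
def clε (ε : ℝ) : ℝ := max 0 (min (1 / 4) ε)

/-- `cl` is continuous. [folklore] -/
theorem continuous_cl : Continuous cl := by unfold cl; fun_prop

/-- `clε` is continuous. [folklore] -/
theorem continuous_clε : Continuous clε := by unfold clε; fun_prop

/-- `cl t ∈ [0,1]`. [folklore] -/
theorem cl_mem (t : ℝ) : 0 ≤ cl t ∧ cl t ≤ 1 := by
  unfold cl
  exact ⟨le_max_left _ _, max_le zero_le_one (min_le_left _ _)⟩

/-- `clε ε ∈ [0,1/4]`. [folklore] -/
theorem clε_mem (ε : ℝ) : 0 ≤ clε ε ∧ clε ε ≤ 1 / 4 := by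
  unfold clε
  exact ⟨le_max_left _ _, max_le (by norm_num) (min_le_left _ _)⟩

/-- `cl` is the identity on `[0,1]`. [folklore] -/
theorem cl_of_mem {t : ℝ} (ht : t ∈ Icc (0:ℝ) 1) : cl t = t := by
  unfold cl
  rw [min_eq_right ht.2, max_eq_right ht.1]

/-- `clε` is the identity on `[0,1/4]`. [folklore] -/
theorem clε_of_mem {ε : ℝ} (hε : ε ∈ Icc (0:ℝ) (1 / 4)) : clε ε = ε := by
  unfold clε
  rw [min_eq_right hε.2, max_eq_right hε.1]

/-- The clamped boundary functional `Jc ε = (1 − 3ε̂) ∮_{∂Δ_ε̂}` (`ε̂ = clε ε`, edge parameter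
clamped by `cl`), a continuous function of `ε ∈ ℝ`. [folklore] -/
def Jc (A B : (Fin 2 → ℝ) → ℝ) (ε : ℝ) : ℝ :=
  (1 - 3 * clε ε) * ((∫ t in (0:ℝ)..1, A (shrink (clε ε) (cl t) 0)) +
    (∫ t in (0:ℝ)..1, (B (shrink (clε ε) (1 - cl t) (cl t)) - A (shrink (clε ε) (1 - cl t) (cl t)))) -
    ∫ t in (0:ℝ)..1, B (shrink (clε ε) 0 (cl t)))

/-- A continuous function on `Δ` composed with a continuous map into `Δ` is continuous. [folklore] -/
theorem continuous_comp_Δ {A : (Fin 2 → ℝ) → ℝ} (hA : ContinuousOn A Δ) {X : Type*}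
    [TopologicalSpace X] {φ : X → Fin 2 → ℝ} (hφ : Continuous φ) (hmem : ∀ x, φ x ∈ Δ) :
    Continuous fun x => A (φ x) :=
  hA.comp_continuous hφ hmem

/-- `Jc` is continuous (parametric interval integrals of jointly continuous integrands). [folklore] -/
theorem continuous_Jc {A B : (Fin 2 → ℝ) → ℝ} (hA : ContinuousOn A Δ) (hB : ContinuousOn B Δ) :
    Continuous (Jc A B) := by
  have hε3 : ∀ ε, clε ε ≤ 1 / 3 := fun ε => (clε_mem ε).2.trans (by norm_num)
  -- joint continuity of the three clamped edge maps `(ε, t) ↦ edge`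
  have c₁ : Continuous fun p : ℝ × ℝ => shrink (clε p.1) (cl p.2) 0 :=
    continuous_shrink₂ _ _ _ (continuous_clε.comp continuous_fst) (continuous_cl.comp continuous_snd)
      continuous_const
  have c₂ : Continuous fun p : ℝ × ℝ => shrink (clε p.1) (1 - cl p.2) (cl p.2) :=
    continuous_shrink₂ _ _ _ (continuous_clε.comp continuous_fst)
      (continuous_const.sub (continuous_cl.comp continuous_snd)) (continuous_cl.comp continuous_snd)
  have c₃ : Continuous fun p : ℝ × ℝ => shrink (clε p.1) 0 (cl p.2) :=
    continuous_shrink₂ _ _ _ (continuous_clε.comp continuous_fst) continuous_const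
      (continuous_cl.comp continuous_snd)
  have m₁ : ∀ p : ℝ × ℝ, shrink (clε p.1) (cl p.2) 0 ∈ Δ := fun p =>
    shrink_mem_Δ (clε_mem _).1 (hε3 _) (cl_mem _).1 le_rfl (by linarith [(cl_mem p.2).2])
  have m₂ : ∀ p : ℝ × ℝ, shrink (clε p.1) (1 - cl p.2) (cl p.2) ∈ Δ := fun p =>
    shrink_mem_Δ (clε_mem _).1 (hε3 _) (by linarith [(cl_mem p.2).2]) (cl_mem _).1 (by linarith)
  have m₃ : ∀ p : ℝ × ℝ, shrink (clε p.1) 0 (cl p.2) ∈ Δ := fun p =>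
    shrink_mem_Δ (clε_mem _).1 (hε3 _) le_rfl (cl_mem _).1 (by linarith [(cl_mem p.2).2])
  have F₁ : Continuous (Function.uncurry fun (ε t : ℝ) => A (shrink (clε ε) (cl t) 0)) :=
    continuous_comp_Δ hA c₁ m₁
  have F₂ : Continuous (Function.uncurry fun (ε t : ℝ) =>
      B (shrink (clε ε) (1 - cl t) (cl t)) - A (shrink (clε ε) (1 - cl t) (cl t))) :=
    (continuous_comp_Δ hB c₂ m₂).sub (continuous_comp_Δ hA c₂ m₂)
  have F₃ : Continuous (Function.uncurry fun (ε t : ℝ) => B (shrink (clε ε) 0 (cl t))) :=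
    continuous_comp_Δ hB c₃ m₃
  have K₁ := intervalIntegral.continuous_parametric_intervalIntegral_of_continuous'
    (μ := volume) F₁ 0 1
  have K₂ := intervalIntegral.continuous_parametric_intervalIntegral_of_continuous'
    (μ := volume) F₂ 0 1
  have K₃ := intervalIntegral.continuous_parametric_intervalIntegral_of_continuous'
    (μ := volume) F₃ 0 1
  unfold Jc
  exact ((continuous_const.sub (continuous_const.mul continuous_clε)).mul ((K₁.add K₂).sub K₃))

/-- On `(0, 1/4)` the clamped functional is the honest one, hence vanishes. [folklore] -/
theorem Jc_eq_zero {A B S : (Fin 2 → ℝ) → ℝ} (hA : ContinuousOn A Δ) (hB : ContinuousOn B Δ)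
    (hS : ∀ p : Fin 2 → ℝ, 0 < p 0 → 0 < p 1 → p 0 + p 1 < 1 →
      HasFDerivAt S (A p • ContinuousLinearMap.proj (R := ℝ) (φ := fun _ : Fin 2 => ℝ) 0 +
        B p • ContinuousLinearMap.proj (R := ℝ) (φ := fun _ : Fin 2 => ℝ) 1) p)
    {ε : ℝ} (hε : ε ∈ Ioo (0:ℝ) (1 / 4)) : Jc A B ε = 0 := by
  have hcl : clε ε = ε := clε_of_mem ⟨hε.1.le, hε.2.le⟩
  have hI : ∀ (f : ℝ → ℝ), ∫ t in (0:ℝ)..1, f (cl t) = ∫ t in (0:ℝ)..1, f t := fun f => by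
    apply intervalIntegral.integral_congr
    intro t ht
    rw [uIcc_of_le zero_le_one] at ht
    simp [cl_of_mem ht]
  unfold Jc
  rw [hcl, hI (fun t => A (shrink ε t 0)), hI (fun t => B (shrink ε (1 - t) t) - A (shrink ε (1 - t) t)),
    hI (fun t => B (shrink ε 0 t))]
  exact green_shrunken hA hB hS hε.1 (hε.2.trans (by norm_num))

/-- At `ε = 0` the clamped functional is the boundary integral over `∂Δ` itself. [folklore] -/
theorem Jc_zero (A B : (Fin 2 → ℝ) → ℝ) :
    Jc A B 0 = (∫ t in (0:ℝ)..1, A ![t, 0]) +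
      (∫ t in (0:ℝ)..1, (B ![1 - t, t] - A ![1 - t, t])) - ∫ t in (0:ℝ)..1, B ![0, t] := by
  have hcl : clε 0 = 0 := clε_of_mem ⟨le_rfl, by norm_num⟩
  have hI : ∀ (f : ℝ → ℝ), ∫ t in (0:ℝ)..1, f (cl t) = ∫ t in (0:ℝ)..1, f t := fun f => by
    apply intervalIntegral.integral_congr
    intro t ht
    rw [uIcc_of_le zero_le_one] at ht
    simp [cl_of_mem ht]
  unfold Jc
  rw [hcl, hI (fun t => A (shrink 0 t 0)), hI (fun t => B (shrink 0 (1 - t) t) - A (shrink 0 (1 - t) t)),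
    hI (fun t => B (shrink 0 0 t))]
  simp only [shrink_zero, mul_zero, sub_zero, one_mul]

/-- **Green on the standard triangle** for coefficients continuous on the CLOSED triangle with a
`C¹` potential on the OPEN triangle: `∫₀¹A(t,0)dt + ∫₀¹(B−A)(1−t,t)dt − ∫₀¹B(0,t)dt = 0`.
Proof: `Jc` is continuous, vanishes on `(0, 1/4)`, hence at `0`. [folklore] -/
theorem green_triangle {A B S : (Fin 2 → ℝ) → ℝ} (hA : ContinuousOn A Δ) (hB : ContinuousOn B Δ)
    (hS : ∀ p : Fin 2 → ℝ, 0 < p 0 → 0 < p 1 → p 0 + p 1 < 1 →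
      HasFDerivAt S (A p • ContinuousLinearMap.proj (R := ℝ) (φ := fun _ : Fin 2 => ℝ) 0 +
        B p • ContinuousLinearMap.proj (R := ℝ) (φ := fun _ : Fin 2 => ℝ) 1) p) :
    (∫ t in (0:ℝ)..1, A ![t, 0]) + (∫ t in (0:ℝ)..1, (B ![1 - t, t] - A ![1 - t, t])) -
      ∫ t in (0:ℝ)..1, B ![0, t] = 0 := by
  rw [← Jc_zero A B]
  have h1 : Tendsto (Jc A B) (𝓝[Ioo (0:ℝ) (1 / 4)] 0) (𝓝 (Jc A B 0)) :=
    ((continuous_Jc hA hB).tendsto 0).mono_left nhdsWithin_le_nhds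
  have h2 : Tendsto (Jc A B) (𝓝[Ioo (0:ℝ) (1 / 4)] 0) (𝓝 0) := by
    refine tendsto_const_nhds.congr' ?_
    exact eventually_nhdsWithin_of_forall fun ε hε => (Jc_eq_zero hA hB hS hε).symm
  haveI : (𝓝[Ioo (0:ℝ) (1 / 4)] 0).NeBot := by
    rw [nhdsWithin_Ioo_eq_nhdsGT (by norm_num : (0:ℝ) < 1 / 4)]
    infer_instance
  exact tendsto_nhds_unique h1 h2

/-! ### §2.3 Soundness of the Green generator and of `M₁` -/

/-- **The Green generator is sound**: every element of `greenSet` evaluates to `0`. So the typed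
conclusion subgroup is not junk, and the crux cannot be proved by exhibiting an unsound instance.
[cite: KontsevichZagier2001, §1.2] -/
theorem eval_eq_zero_of_mem_greenSet {g : KZ.FormalRep} (hg : g ∈ greenSet) : KZ.eval g = 0 := by
  obtain ⟨Δ', A, B, S, r₀₁, r₁₂, r₀₂, hΔ, -, -, hAc, hBc, hS, hd₁, hd₂, hd₃, hi₁, hi₂, hi₃, rfl⟩ := hg
  subst hΔ
  simp only [map_sub, map_add, KZ.eval_of, KZ.IntegralRep.value]
  have e₁ : ∫ z in r₀₁.domain, r₀₁.integrand z = ∫ t in (0:ℝ)..1, A ![t, 0] := by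
    rw [hd₁, ← setIntegral_unitDom (fun t => A ![t, 0])]
    refine setIntegral_congr_fun measurableSet_unitDom fun z hz => ?_
    exact hi₁ z (hd₁ ▸ hz)
  have e₂ : ∫ z in r₁₂.domain, r₁₂.integrand z =
      ∫ t in (0:ℝ)..1, (B ![1 - t, t] - A ![1 - t, t]) := by
    rw [hd₂, ← setIntegral_unitDom (fun t => B ![1 - t, t] - A ![1 - t, t])]
    refine setIntegral_congr_fun measurableSet_unitDom fun z hz => ?_
    exact hi₂ z (hd₂ ▸ hz)
  have e₃ : ∫ z in r₀₂.domain, r₀₂.integrand z = ∫ t in (0:ℝ)..1, B ![0, t] := by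
    rw [hd₃, ← setIntegral_unitDom (fun t => B ![0, t])]
    refine setIntegral_congr_fun measurableSet_unitDom fun z hz => ?_
    exact hi₃ z (hd₃ ▸ hz)
  rw [e₁, e₂, e₃]
  exact green_triangle hAc hBc hS

/-- **`M₁` is sound**: the conclusion subgroup of the crux lies in the kernel of evaluation
(rules 1a, 1b, 2 by the tree's soundness theorems, Green by `eval_eq_zero_of_mem_greenSet`).
Consequently `M₁ ≠ ⊤`, the crux is not vacuously true, and `eval c = 0` is NECESSARY for
`c ∈ M₁`. [cite: KontsevichZagier2001, §1.2] -/
theorem M₁_le_ker_eval : M₁ ≤ KZ.eval.ker := by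
  refine (AddSubgroup.closure_le _).mpr ?_
  rintro c (((hc | hc) | hc) | hc)
  · exact KZ.eval_eq_zero_of_mem_domainAddRel_holds hc
  · exact KZ.eval_eq_zero_of_mem_integrandAddRel_holds hc
  · exact KZ.eval_eq_zero_of_mem_changeOfVariablesRel_holds hc
  · exact eval_eq_zero_of_mem_greenSet hc

/-- Elements of `M₁` evaluate to `0`. [cite: KontsevichZagier2001, §1.2] -/
theorem eval_eq_zero_of_mem_M₁ {c : KZ.FormalRep} (hc : c ∈ M₁) : KZ.eval c = 0 :=
  M₁_le_ker_eval hc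


end Summit.KontsevichZagierPeriods.SymplecticScissors.RealOnePeriodRelationsNegative

end
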